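import Summits.ResolutionOfSingularities.ResolutionOfSingularities.Theses.Descent
import Literature.AlgebraicGeometry.Resolution.ZariskiPatchingProperModelsWeakLU
import Literature.AlgebraicGeometry.Resolution.LocalUniformization
import Literature.AlgebraicGeometry.Resolution.ProperModelsPatching
import HarnessLib

/-!
# Sketch — crux idea `valuative-constant-step` for crux stmt-ResolutionOfSingularities-0549
# (`Theses.Descent.DescentPerfectToAll`), lens "Picover / p-alteration" (res-B-lens-3)

Typed local shadow of the crux under its own antecedent: `RRLU1Const p` — one-step CONSTANT
radicial descent of local uniformization along a valuation (the generator `y` of the height-one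
purely inseparable step `L/K` has `y ^ p` a CONSTANT, i.e. in the ground field `k`). Vacuous over
perfect `k`. First lemma `LuOfConstStep`; transfer certificate
`descentPerfectToAll_of_constStep` (C⁺ → crux, kernel-checked); bookkeeping converse
`rrLU1Const_of_lu`. Nothing here proves resolution in characteristic `p`.
-/

noncomputable section

set_option linter.dupNamespace false

open AlgebraicGeometry CategoryTheory Literature.AlgebraicGeometry.Resolution

namespace Summit.ResolutionOfSingularities.ResolutionOfSingularities.Cruxes.DescentPerfectToAll.ValuativeConstantStep

/-- The crux's antecedent at `p` (verbatim shape): resolution of reduced separated finite-type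
schemes over PERFECT fields of characteristic `p`. -/
def PerfectRes (p : ℕ) : Prop :=
  ∀ (k : Type) [Field k] [CharP k p] [PerfectField k] (X : Scheme.{0}) (f : X ⟶ Spec (.of k)),
    IsSeparated f → LocallyOfFiniteType f → QuasiCompact f → IsReduced X → Scheme.HasResolution X

/-- `RRLU1Const_p` — ONE-STEP CONSTANT RADICIAL DESCENT OF LOCAL UNIFORMIZATION: for fields
`k ⊆ K ⊆ L` of characteristic `p` with `K/k` finitely generated and `L = K(y)` purely inseparable
with `y ^ p ∈ k` (a p-th root of a CONSTANT), every finitely generated REGULAR `k`-subalgebra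
`B ⊆ L` with `Frac B = L` lying in a valuation ring `O` of `L` forces local uniformizability of
`O ∩ K` over `k`. (Same binder shape as the inlined `RRLU1_p` of
`Theorems/PAlterationPialtSqueezeRRLU1.lean`, with `y ^ p ∈ range (algebraMap K L)` replaced by
`y ^ p ∈ range (algebraMap k L)`.) Vacuously true over perfect `k`. -/
def RRLU1Const (p : ℕ) : Prop :=
  ∀ (k K L : Type) [Field k] [CharP k p] [Field K] [Field L] [Algebra k K] [Algebra K L]
    [Algebra k L] [IsScalarTower k K L], (⊤ : IntermediateField k K).FG →
    IsPurelyInseparable K L →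
    (∃ y : L, y ^ p ∈ (algebraMap k L).range ∧ IntermediateField.adjoin K {y} = ⊤) →
    ∀ B : Subalgebra k L, B.FG → IsFractionRing B L → IsRegularRing B →
    ∀ O : ValuationSubring L, B.toSubring ≤ O.toSubring →
      IsLocallyUniformizable k K (O.comap (algebraMap K L))

/-- FIRST LEMMA of the line (genuine, believed provable: perfect-closure LU from the antecedent,
finitely generated descent to `k(c₁^{1/pⁿ},…,c_s^{1/pⁿ})`, faithfully flat descent of regularity,
then peel the constant tower one height-one step at a time, upgrading "regular at the centre" to a
regular affine model by openness of the regular locus). -/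
def LuOfConstStep (p : ℕ) : Prop :=
  PerfectRes p → RRLU1Const p → LocalUniformizationInChar.{0} p

/-- The patching conjunct of the residue, under the antecedent (two-model patching of proper
models over all fields of characteristic `p`; route Valuative's `PatchingRel` territory). -/
def TmpOfPerfectRes (p : ℕ) : Prop :=
  PerfectRes p → ProperModel.TwoModelPatching.{0} p

/-- TRANSFER CERTIFICATE: `C⁺ := LuOfConstStep ∧ RRLU1Const ∧ TmpOfPerfectRes` (primewise) gives
the crux BY NAME, through `resolutionInChar_iff_twoModelPatching_and_lu`. -/
theorem descentPerfectToAll_of_constStep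
    (h1 : ∀ p : ℕ, p.Prime → LuOfConstStep p)
    (h2 : ∀ p : ℕ, p.Prime → RRLU1Const p)
    (h3 : ∀ p : ℕ, p.Prime → TmpOfPerfectRes p) :
    Summit.ResolutionOfSingularities.ResolutionOfSingularities.Theses.Descent.DescentPerfectToAll := by
  intro p hp hP
  exact resolutionInChar_iff_twoModelPatching_and_lu.mpr ⟨h3 p hp hP, h1 p hp hP (h2 p hp)⟩

/-- Bookkeeping converse: the crux's consequent at `p` already gives `RRLU1Const p` (LU of
`O ∩ K` outright), so `RRLU1Const` is implied by, not stronger than, the target. -/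
theorem rrLU1Const_of_lu {p : ℕ} (h : LocalUniformizationInChar.{0} p) : RRLU1Const p := by
  intro k K L _ _ _ _ _ _ _ _ hfg _ _ B _ _ _ O hBO
  refine h k K hfg (O.comap (algebraMap K L)) ?_
  intro c
  rw [ValuationSubring.mem_comap, ← IsScalarTower.algebraMap_apply]
  exact hBO (B.algebraMap_mem c)

/-- Same certificate with the crux's consequent split differently: under the antecedent the
consequent `ResolutionInChar p` is EQUIVALENT to `RRLU1Const p ∧ TwoModelPatching p` once
`LuOfConstStep p` is known. -/
theorem resolutionInChar_iff_constStep_and_tmp {p : ℕ} (hp : p.Prime) (h1 : LuOfConstStep p)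
    (hP : PerfectRes p) :
    ResolutionInChar.{0} p ↔ RRLU1Const p ∧ ProperModel.TwoModelPatching.{0} p := by
  constructor
  · intro h
    have h' := resolutionInChar_iff_twoModelPatching_and_lu.mp h
    exact ⟨rrLU1Const_of_lu h'.2, h'.1⟩
  · intro h
    exact resolutionInChar_iff_twoModelPatching_and_lu.mpr ⟨h.2, h1 hP h.1⟩

end Summit.ResolutionOfSingularities.ResolutionOfSingularities.Cruxes.DescentPerfectToAll.ValuativeConstantStep

end
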